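import Summits.CriticalPhenomena.PercolationContinuityZ3.Theorems.PercNearOneGluingNoHeavyLowerTailStarSetClassForestComonotone
import HarnessLib

/-!
# `NoHeavyLowerTail` (stmt-CriticalPhenomena-4575) — the class-forest certificate at an ARBITRARY base configuration (pointwise brick)

Support file (prover `prim-gen-swap` gen 9; `--supports stmt-CriticalPhenomena-4575`).  No definitions, no named facts, no sorries.

`StarSet.comonotone_word_nonneg_classForest` instantiates the abstract forest certificate `StarSet.forestCertificate_core` at the
configuration off the stars and integrates at once.  The mixed certificate of seat memo MWF-CERT.md (§3–§4: forest classes paid by champion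
rows, chord classes by pair rows) needs the same instantiation POINTWISE and at a SHIFTED base configuration (the configuration off the stars
with the links of an arbitrary set of chord classes added), and with the `c`-part removed (`g := 0` in the core).  This file provides exactly
that brick, with no reference to stars or to `c`:

* `StarSet.classForest_lonely_le_champion_base` — for class ports `P, P'` in a leaf-peeling order, class weights `Θ ∈ [0,1]`, `j ≤ 2`,
  and ANY configuration `ω₀`:
  `Σ_S W(S)·1[1 ≤ |π_{ω₀}(P_S)| ≤ j] ≤ Σ_I c_I · Σ_S W(S)·1[|π_{ω₀ ∪ L_S}(P I)| ≤ j]`,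
  `W(S) = Π_{I∈S}Θ_I Π_{I∉S}(1−Θ_I)`, `c_I = Θ_I Π_{K<I}(1−Θ_K)`, `L_S = {P I P' I : I ∈ S}`.
-/

noncomputable section

namespace Summit.CriticalPhenomena.PercolationContinuityZ3.Theorems

open MeasureTheory Set Literature.Probability.LatticeModels Literature.Probability.Percolation
open scoped Classical BigOperators

variable {n M : ℕ}

namespace StarSet

/-- **Class-forest certificate at an arbitrary base configuration** (see the file header): the lonely patterns are paid by the nested
champion budgets of the designated class ports. [this file; forest core `StarSet.forestCertificate_core` with `g := 0`] -/
theorem classForest_lonely_le_champion_base (A : Finset (Fin n)) (P P' : Fin M → Fin n) (Θ : Fin M → ℝ)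
    (hΘ0 : ∀ I, 0 ≤ Θ I) (hΘ1 : ∀ I, Θ I ≤ 1) (j : ℕ) (hj : j ≤ 2)
    (hPA : ∀ I, P I ∈ A) (hP'A : ∀ I, P' I ∈ A) (hPP' : ∀ I, P I ≠ P' I)
    (hforest : ∀ K I, K < I → P' K ≠ P I ∧ P' K ≠ P' I) (ω₀ : BondConfig (Fin n)) :
    ∑ S ∈ (Finset.univ : Finset (Fin M)).powerset, ((∏ I ∈ S, Θ I) * ∏ I ∈ Finset.univ \ S, (1 - Θ I)) *
        DecisionTree.ind {ω' : BondConfig (Fin n) |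
          1 ≤ (A.filter fun z => ∃ u ∈ S.image P ∪ S.image P', (openGraph ω').Reachable u z).card ∧
          (A.filter fun z => ∃ u ∈ S.image P ∪ S.image P', (openGraph ω').Reachable u z).card ≤ j} ω₀ ≤
      ∑ I, (Θ I * ∏ K ∈ Finset.univ.filter (· < I), (1 - Θ K)) *
        ∑ S ∈ (Finset.univ : Finset (Fin M)).powerset, ((∏ I ∈ S, Θ I) * ∏ I ∈ Finset.univ \ S, (1 - Θ I)) *
          DecisionTree.ind {ω' : BondConfig (Fin n) |
            (A.filter fun z => (openGraph (ω' ∪ ↑(S.image fun I => (s(P I, P' I) : Sym2 (Fin n))))).Reachable (P I) z).card ≤ j} ω₀ := by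
  set W : Finset (Fin M) → ℝ := fun S => (∏ I ∈ S, Θ I) * ∏ I ∈ Finset.univ \ S, (1 - Θ I) with hW
  set cf : Fin M → ℝ := fun I => Θ I * ∏ K ∈ Finset.univ.filter (· < I), (1 - Θ K) with hcf
  set D₂ : Finset (Fin M) → Set (BondConfig (Fin n)) := fun S => {ω' |
    1 ≤ (A.filter fun z => ∃ u ∈ S.image P ∪ S.image P', (openGraph ω').Reachable u z).card ∧
    (A.filter fun z => ∃ u ∈ S.image P ∪ S.image P', (openGraph ω').Reachable u z).card ≤ j} with hD₂
  set Sp : Fin n → Finset (Fin M) → Set (BondConfig (Fin n)) := fun v S => {ω' |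
    (A.filter fun z => (openGraph (ω' ∪ ↑(S.image fun I => (s(P I, P' I) : Sym2 (Fin n))))).Reachable v z).card ≤ j} with hSp
  change ∑ S ∈ (Finset.univ : Finset (Fin M)).powerset, W S * DecisionTree.ind (D₂ S) ω₀ ≤
    ∑ I, cf I * ∑ S ∈ (Finset.univ : Finset (Fin M)).powerset, W S * DecisionTree.ind (Sp (P I) S) ω₀
  -- no two classes have the same pair of ports (leaf peeling)
  have hnopar : ∀ I K : Fin M, I ≠ K → ¬ ((P K = P I ∨ P K = P' I) ∧ (P' K = P I ∨ P' K = P' I)) := by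
    intro I K hIK hpar
    rcases lt_or_gt_of_ne hIK with h | h
    · have hf := hforest I K h
      obtain ⟨h1, h2⟩ := hpar
      rcases h1 with h1 | h1 <;> rcases h2 with h2 | h2
      · exact hPP' K (h1.trans h2.symm)
      · exact hf.2 h2.symm
      · exact hf.1 h1.symm
      · exact hPP' K (h1.trans h2.symm)
    · exact (hforest K I h).elim (fun h1 h2 => hpar.2.elim h1 h2)
  have hlonelyOf : ∀ I, DecisionTree.ind (D₂ {I}) ω₀ ≠ 0 →
      (A.filter fun z => ∃ u ∈ ({I} : Finset (Fin M)).image P ∪ ({I} : Finset (Fin M)).image P',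
        (openGraph ω₀).Reachable u z).card ≤ j := by
    intro I hne
    by_cases hω : ω₀ ∈ D₂ {I}
    · simp only [hD₂, mem_setOf_eq] at hω
      exact hω.2
    · exact absurd (DecisionTree.ind_of_not_mem hω) hne
  -- the abstract core with `g := 0`
  have hcore := forestCertificate_core Θ hΘ0 hΘ1 P P' hforest (fun _ => (0 : ℝ)) (fun S => DecisionTree.ind (D₂ S) ω₀)
    (fun v S => DecisionTree.ind (Sp v S) ω₀)
    (fun I => DecisionTree.ind (D₂ {I}) ω₀ ≠ 0 ∧ ¬ (openGraph ω₀).Reachable (P I) (P' I))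
    (fun I => DecisionTree.ind (D₂ {I}) ω₀ ≠ 0 ∧ (openGraph ω₀).Reachable (P I) (P' I))
    (fun S => le_refl _) ?_ (fun I => BHK2006.ind_le_one _ _) (fun v S => DecisionTree.ind_nonneg _ _) ?_ ?_ ?_ ?_ ?_
  · -- unpack the core: Σ_I cf_I Σ_S W (0 − sp) ≤ Σ_S W (0 − ℓ)
    have h1 : ∑ I, cf I * ∑ S ∈ (Finset.univ : Finset (Fin M)).powerset, W S * (0 - DecisionTree.ind (Sp (P I) S) ω₀) =
        -(∑ I, cf I * ∑ S ∈ (Finset.univ : Finset (Fin M)).powerset, W S * DecisionTree.ind (Sp (P I) S) ω₀) := by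
      rw [← Finset.sum_neg_distrib]
      refine Finset.sum_congr rfl fun I _ => ?_
      rw [← mul_neg, ← Finset.sum_neg_distrib]
      congr 1
      exact Finset.sum_congr rfl fun S _ => by ring
    have h2 : ∑ S ∈ (Finset.univ : Finset (Fin M)).powerset, W S * (0 - DecisionTree.ind (D₂ S) ω₀) =
        -(∑ S ∈ (Finset.univ : Finset (Fin M)).powerset, W S * DecisionTree.ind (D₂ S) ω₀) := by
      rw [← Finset.sum_neg_distrib]
      exact Finset.sum_congr rfl fun S _ => by ring
    have h := hcore
    rw [h1, h2] at h
    linarith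
  · -- only singletons are lonely
    intro S hS
    refine DecisionTree.ind_of_not_mem fun hω => ?_
    simp only [hD₂, mem_setOf_eq] at hω
    obtain ⟨I, rfl⟩ := portPattern_lonely_singleton' ω₀ A P P' S j hj hPA hP'A hPP'
      (fun I _ K _ hIK => hnopar I K hIK) (hω.1.trans_eq (card_filter_congr fun _ _ => Iff.rfl))
      ((card_filter_congr fun _ _ => Iff.rfl).trans_le hω.2)
    exact hS I rfl
  · -- lonely classes are of type A or B
    intro I hne
    by_cases h : (openGraph ω₀).Reachable (P I) (P' I)
    · exact Or.inr ⟨hne, h⟩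
    · exact Or.inl ⟨hne, h⟩
  · -- type A: budget events Z and E
    rintro I ⟨hne, hA⟩
    have hl := hlonelyOf I hne
    constructor
    · intro S hS
      refine DecisionTree.ind_of_mem ?_
      simp only [hSp, mem_setOf_eq]
      exact (card_filter_congr fun _ _ => Iff.rfl).trans_le
        (lonely_port_light_closed ω₀ A P P' I S j hj hPA hP'A hPP' ((card_filter_congr fun _ _ => Iff.rfl).trans_le hl) hA
          (fun K hK => ⟨fun h => hS K (Or.inl h) hK, fun h => hS K (Or.inr h) hK⟩))
    · intro S _ hS
      have h2 := lonely_ports_light_adj ω₀ A P P' I S j hj hPA hP'A hPP' ((card_filter_congr fun _ _ => Iff.rfl).trans_le hl)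
        (fun K hK hKI hadj => hS K hKI hadj hK)
      exact ⟨DecisionTree.ind_of_mem (by
          simp only [hSp, mem_setOf_eq]; exact (card_filter_congr fun _ _ => Iff.rfl).trans_le h2.1),
        DecisionTree.ind_of_mem (by
          simp only [hSp, mem_setOf_eq]; exact (card_filter_congr fun _ _ => Iff.rfl).trans_le h2.2)⟩
  · -- type B: budget event F
    rintro I ⟨hne, -⟩ S hS
    have h2 := lonely_ports_light_adj ω₀ A P P' I S j hj hPA hP'A hPP' ((card_filter_congr fun _ _ => Iff.rfl).trans_le (hlonelyOf I hne))
      (fun K hK hKI hadj => hS K hKI hadj hK)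
    exact ⟨DecisionTree.ind_of_mem (by
        simp only [hSp, mem_setOf_eq]; exact (card_filter_congr fun _ _ => Iff.rfl).trans_le h2.1),
      DecisionTree.ind_of_mem (by
        simp only [hSp, mem_setOf_eq]; exact (card_filter_congr fun _ _ => Iff.rfl).trans_le h2.2)⟩
  · -- types A and B never adjacent
    rintro K I ⟨hneK, hAK⟩ ⟨hneI, hBI⟩ hadj
    exact lonely_types_exclusive ω₀ A P P' K I j hj hPA hP'A hPP' ((card_filter_congr fun _ _ => Iff.rfl).trans_le (hlonelyOf K hneK)) hAK hBI hadj
  · -- two type-B lonely classes never adjacent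
    rintro I I' hII' ⟨hneI, hBI⟩ ⟨hneI', hBI'⟩ hadj
    have h1 := lonely_typeB_ports_subset ω₀ A P P' I I' j hj hPA hP'A hPP' ((card_filter_congr fun _ _ => Iff.rfl).trans_le (hlonelyOf I' hneI')) hBI hadj
    rcases lt_or_gt_of_ne hII' with h | h
    · exact (hforest I I' h).elim (fun ha hb => h1.2.elim ha hb)
    · have hadj' : P I' = P I ∨ P I' = P' I ∨ P' I' = P I ∨ P' I' = P' I := by
        rcases hadj with h' | h' | h' | h'
        · exact Or.inl h'.symm
        · exact Or.inr (Or.inr (Or.inl h'.symm))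
        · exact Or.inr (Or.inl h'.symm)
        · exact Or.inr (Or.inr (Or.inr h'.symm))
      have h2 := lonely_typeB_ports_subset ω₀ A P P' I' I j hj hPA hP'A hPP' ((card_filter_congr fun _ _ => Iff.rfl).trans_le (hlonelyOf I hneI)) hBI' hadj'
      exact (hforest I' I h).elim (fun ha hb => h2.2.elim ha hb)

end StarSet

end Summit.CriticalPhenomena.PercolationContinuityZ3.Theorems

end
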